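import Literature.AlgebraicGeometry.Resolution.HenselizedFunctionFieldsImmediate
import Mathlib.FieldTheory.PrimitiveElement
import Mathlib.FieldTheory.AlgebraicClosure
import Mathlib.FieldTheory.Normal.Basic
import HarnessLib

/-!
# Conjugates over a henselian subfield, reduction of polynomials, primitive residues (towards Kuhlmann 2010, Prop. 2.18)

Topic: `Literature/AlgebraicGeometry/Resolution` (valued function fields). PROVED elementary
valuation theory used by `HenselizedFunctionFieldsBaseChangeProofs.lean` to discharge the named
fact `Kuhlmann2010DefectUnramifiedBaseChange` (`HenselizedFunctionFields.lean`) = F.-V. Kuhlmann,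
*Elimination of ramification I: The generalized stability theorem*, Trans. AMS 362 (2010)
5697–5727 = arXiv:1003.5678, **Prop. 2.18** ("Let `(K,v)` be a henselian field and `N` an
arbitrary algebraic extension of `K` within `K^r`. If `L|K` is a finite extension, then
`d(L|K,v) = d(L.N|N,v)`"), in the finite unramified case in which it is vendored. The source
proves Prop. 2.18 in [K6] (F.-V. Kuhlmann, *A classification of Artin–Schreier defect
extensions and characterizations of defectless fields*, Illinois J. Math. 54 (2010), Prop. 2.8)
through the absolute ramification field `K^r`; for a FINITE UNRAMIFIED `N|K` the statement is
reached by the classical argument "unramified extensions of a henselian field are generated by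
a lift of a primitive residue, and stay unramified under base change", whose ingredients are
collected here, in the ambient rendering of `ValuedFunctionFields.lean` / `DefectAmbient.lean`
(one algebraically closed valued field `(Ω, V)`, fields = subfields `M ≤ Ω` valued by `V ∩ M`,
residue fields `Mv = residueSubfield M V ≤ Ωv`).

## Content (everything PROVED)

* `IsHenselianField.aeval_mem_iff_of_aeval_minpoly`, `IsHenselianField.mem_of_aeval_minpoly` —
  **conjugation over a henselian `M` respects `V` and `𝔪_V`**: if `y` is a root of the minimal
  polynomial of `x` over `M`, then `P(x) ∈ V ↔ P(y) ∈ V` and `v(P(x)) < 1 ↔ v(P(y)) < 1` for all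
  `P ∈ M[X]` (so the `M`-conjugates of an element of `V` lie in `V`): `y = σ(x)` for an
  `M`-automorphism `σ` of the relative algebraic closure of `M` in `Ω` (Mathlib's
  `algebraicClosure`, a normal extension; `Normal.minpoly_eq_iff_mem_orbit`), and `σ` stabilises
  the unique extension of `V ∩ M` (§1.1: "the extension of `v` from `K` to every algebraic
  extension field is unique"; `comap_smul_algEquiv`, `ValuationConjugation.lean`).
* `exists_lift_of_residueSubfield` — a polynomial over `Mv` lifts to `M[X]` with coefficients in
  `V ∩ M`, compatibly with evaluation at elements of `V` and reduction.
* `exists_monic_map_eq_prod_residue` — a monic `q ∈ M[X]` whose roots lie in `V` reduces to a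
  monic `q₀ ∈ Mv[X]` of the same degree whose roots are the residues of the roots of `q`.
* `relfinrank_adjoin_simple_eq_natDegree`, `adjoin_simple_toSubfield_le` — `[F(a) : F]` and
  `F(a) ≤ T` for subfields.
* `IsUnramifiedOver.exists_primitive_residue` — for `N|F` finite unramified, a primitive element
  `ā` of the finite separable `Nv|Fv` (`Field.exists_primitive_element`), of degree `[N : F]`.
* `IsHenselianField.exists_roots_lift_nodup` — over a henselian `F`, for `a ∈ V` with
  separable residue `ā` and `deg minpoly_F(a) ≤ deg minpoly_{Fv}(ā)`: the degrees agree and the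
  residues of the roots of `minpoly_F(a)` are pairwise distinct.
* `IsHenselianField.natDegree_minpoly_le_of_nodup` — over a henselian `E`, if the residues of
  the roots of `minpoly_E(a)` are pairwise distinct then `deg minpoly_E(a) ≤ deg minpoly_{Ev}(ā)`
  (they are roots of `minpoly_{Ev}(ā)`).

## Sources

* F.-V. Kuhlmann, Trans. AMS 362 (2010) = arXiv:1003.5678: §1.1 (henselian fields: uniqueness
  of the extension), §1.2 (unramified extensions), §2.3 Prop. 2.18; [K6] Prop. 2.8. The
  arguments themselves are standard valuation theory ([folklore]; cf. O. Endler, *Valuation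
  theory* (1972), §§16–20).

## Rendering notes

* `IsScalarTower (residueSubfield F V) (residueSubfield E V) (ResidueField V)` by `rfl` is
  avoided on purpose (its kernel check does not terminate in time); integrality over the larger
  residue subfield is obtained from finiteness instead (`isAlgebraic_of_relfinrank_pos`).
-/

noncomputable section

open IsLocalRing Polynomial
open scoped Pointwise IntermediateField

namespace Literature.AlgebraicGeometry.Resolution

universe u

variable {Ω : Type u} [Field Ω] (V : ValuationSubring Ω)

/-! ### Conjugates over a henselian subfield stay in `V` -/

/-- **Over a henselian subfield, conjugation does not change values modulo `V`.** Let `M ≤ Ω`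
(`Ω` algebraically closed) be henselian for `V ∩ M`, `x ∈ Ω` integral over `M` and `y` a root
of its minimal polynomial. Then for every `P ∈ M[X]`: `P(x) ∈ V ↔ P(y) ∈ V` and
`v(P(x)) < 1 ↔ v(P(y)) < 1`. Indeed `y = σ(x)` for an `M`-automorphism `σ` of the relative
algebraic closure `A` of `M` in `Ω` (a normal extension of `M`), and `σ` stabilises `V ∩ A`,
the unique extension of `V ∩ M` to `A`. [cite: Kuhlmann2010, Section 1.1] -/
theorem IsHenselianField.aeval_mem_iff_of_aeval_minpoly [IsAlgClosed Ω] {M : Subfield Ω}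
    (hM : IsHenselianField M (V.comap (algebraMap M Ω))) {x y : Ω} (hx : IsIntegral M x)
    (hy : aeval y (minpoly M x) = 0) (P : Polynomial M) :
    (aeval x P ∈ V ↔ aeval y P ∈ V) ∧
      (V.valuation (aeval x P) < 1 ↔ V.valuation (aeval y P) < 1) := by
  -- the relative algebraic closure `A` of `M` in `Ω`: an algebraic closure of `M`, hence normal
  let A : IntermediateField M Ω := algebraicClosure M Ω
  have hya : IsAlgebraic M y := ⟨minpoly M x, minpoly.ne_zero hx, hy⟩
  have hyi : IsIntegral M y := hya.isIntegral
  set x' : A := ⟨x, mem_algebraicClosure_iff'.mpr hx⟩ with hx'def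
  set y' : A := ⟨y, mem_algebraicClosure_iff'.mpr hyi⟩ with hy'def
  have hx'i : IsIntegral M x' := Algebra.IsIntegral.isIntegral x'
  have hmx : minpoly M x' = minpoly M x :=
    (minpoly.algebraMap_eq (algebraMap A Ω).injective x').symm.trans rfl
  have hmy : minpoly M x' = minpoly M y' := by
    refine minpoly.eq_of_irreducible_of_monic (minpoly.irreducible hx'i) ?_ (minpoly.monic hx'i)
    apply Subtype.val_injective
    change ((aeval y' (minpoly M x') : A) : Ω) = ((0 : A) : Ω)
    rw [← IntermediateField.aeval_coe (S := A) y' (minpoly M x'), hmx, ZeroMemClass.coe_zero]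
    exact hy
  obtain ⟨σ, hσ⟩ := MulAction.mem_orbit_iff.mp
    ((Normal.minpoly_eq_iff_mem_orbit (F := M) (E := A)).mp hmy.symm)
  -- `σ` stabilises `W = V ∩ A` by henselianity of `M`
  set W : ValuationSubring A := V.comap (algebraMap A Ω) with hWdef
  have h1 : W.comap (algebraMap M A) = V.comap (algebraMap M Ω) := by
    rw [hWdef, ValuationSubring.comap_comap, ← IsScalarTower.algebraMap_eq]
  have hW : σ • W = W := hM A inferInstance (σ • W) W (by rw [comap_smul_algEquiv, h1]) h1
  -- evaluation of `P` commutes with `σ` and with the inclusion `A ⊆ Ω`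
  have hxP : aeval x P = algebraMap A Ω (aeval x' P) := IntermediateField.aeval_coe (S := A) x' P
  have hyP : aeval y P = algebraMap A Ω (aeval y' P) := IntermediateField.aeval_coe (S := A) y' P
  have hσP : σ • aeval x' P = aeval y' P := by
    rw [← hσ, AlgEquiv.smul_def, AlgEquiv.smul_def, aeval_algHom_apply]
  refine ⟨?_, ?_⟩
  · rw [hxP, hyP, ← ValuationSubring.mem_comap (A := V) (f := algebraMap A Ω),
      ← ValuationSubring.mem_comap (A := V) (f := algebraMap A Ω), ← hWdef, ← hσP,
      smul_mem_iff_of_smul_eq hW]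
  · rw [hxP, hyP, ← valuation_comap_lt_one_iff V (algebraMap A Ω),
      ← valuation_comap_lt_one_iff V (algebraMap A Ω), ← hWdef, ← hσP,
      valuation_smul_lt_one_iff_of_smul_eq hW]

/-- In particular the `M`-conjugates of an element of `V` integral over the henselian `M` lie in
`V`. [cite: Kuhlmann2010, Section 1.1] -/
theorem IsHenselianField.mem_of_aeval_minpoly [IsAlgClosed Ω] {M : Subfield Ω}
    (hM : IsHenselianField M (V.comap (algebraMap M Ω))) {x y : Ω} (hx : IsIntegral M x)
    (hy : aeval y (minpoly M x) = 0) (hxV : x ∈ V) : y ∈ V := by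
  have h := (hM.aeval_mem_iff_of_aeval_minpoly V hx hy X).1
  rw [aeval_X, aeval_X] at h
  exact h.mp hxV

/-! ### Lifting polynomials from the residue field of a subfield -/

/-- **Lifting from `Mv[X]` to `(V ∩ M)[X]`.** For a subfield `M ≤ Ω` and `φ ∈ Mv[X]` (`Mv` the
residue subfield of `M` in `Ωv`) there is `Φ ∈ M[X]` with coefficients in `V ∩ M` reducing to
`φ`: for every `z ∈ V`, `Φ(z) ∈ V` and `v(Φ(z)) < 1 ↔ φ(z̄) = 0`. [folklore] -/
theorem exists_lift_of_residueSubfield (M : Subfield Ω)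
    (φ : Polynomial (residueSubfield M V)) :
    ∃ Φ : Polynomial M, ∀ (z : Ω) (hz : z ∈ V), aeval z Φ ∈ V ∧
      (V.valuation (aeval z Φ) < 1 ↔ aeval (residue V ⟨z, hz⟩) φ = 0) := by
  set O : ValuationSubring M := V.comap (algebraMap M Ω) with hOdef
  set ι : O →+* V := comapSubringHom M V with hιdef
  set θ : O →+* ResidueField V := (residue V).comp ι with hθdef
  set φκ := φ.map (algebraMap (residueSubfield M V) (ResidueField V)) with hφκdef
  have hlifts : φκ ∈ Polynomial.lifts θ := by
    rw [lifts_iff_coeff_lifts]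
    intro i
    rw [hφκdef, coeff_map]
    obtain ⟨c, hc, hr⟩ := (mem_residueSubfield_iff M V _).mp (φ.coeff i).2
    exact ⟨⟨c, hc⟩, hr⟩
  obtain ⟨Φ₀, hΦ₀⟩ := (mem_lifts _).mp hlifts
  refine ⟨Φ₀.map O.subtype, fun z hz => ?_⟩
  set w : V := ⟨z, hz⟩ with hwdef
  -- `Φ(z)` is the image of `(Φ₀.map ι)(w) ∈ V`
  have hev : aeval z (Φ₀.map O.subtype) = (((Φ₀.map ι).eval w : V) : Ω) := by
    rw [aeval_def, eval₂_map, eval_map, show (((Φ₀.eval₂ ι w : V)) : Ω) = V.subtype (Φ₀.eval₂ ι w) from rfl,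
      hom_eval₂]
    rfl
  -- and its residue is `φ(z̄)`
  have hres : residue V ((Φ₀.map ι).eval w) = aeval (residue V w) φ := by
    rw [eval_map, hom_eval₂, ← hθdef, ← eval_map, hΦ₀, hφκdef, eval_map, ← aeval_def]
  refine ⟨by rw [hev]; exact SetLike.coe_mem _, ?_⟩
  rw [hev, ← ValuationSubring.valuation_lt_one_iff, ← residue_eq_zero_iff, hres]

/-! ### Reduction of monic polynomials whose roots lie in `V` -/

/-- **Reduction modulo `𝔪_V` of a monic polynomial over a subfield whose roots lie in `V`.**
For `M ≤ Ω` (`Ω` algebraically closed) and `q ∈ M[X]` monic all of whose roots in `Ω` lie in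
`V`: the roots lift to a multiset `s` of elements of `V`, and there is a monic `q₀ ∈ Mv[X]` of
the same degree whose image in `Ωv[X]` is `∏_{r ∈ s} (X - r̄)` (the coefficients of
`q = ∏_{r ∈ s} (X - r)` lie in `V ∩ M`, and `q₀` is its reduction). [folklore] -/
theorem exists_monic_map_eq_prod_residue [IsAlgClosed Ω] (M : Subfield Ω) {q : Polynomial M}
    (hq : q.Monic) (hroots : ∀ r ∈ (q.map (algebraMap M Ω)).roots, r ∈ V) :
    ∃ (s : Multiset V) (q₀ : Polynomial (residueSubfield M V)),
      s.map Subtype.val = (q.map (algebraMap M Ω)).roots ∧ q₀.Monic ∧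
      q₀.natDegree = q.natDegree ∧
      q₀.map (algebraMap (residueSubfield M V) (ResidueField V)) =
        ((s.map (residue V)).map fun b => X - C b).prod := by
  classical
  set qΩ := q.map (algebraMap M Ω) with hqΩdef
  have hmon : qΩ.Monic := hq.map _
  have hsplit : qΩ.Splits := IsAlgClosed.splits qΩ
  -- the roots, lifted to `V`
  obtain ⟨s, hs⟩ : ∃ s : Multiset V, s.map Subtype.val = qΩ.roots := by
    refine ⟨qΩ.roots.attach.map fun r => ⟨r.1, hroots r.1 r.2⟩, ?_⟩
    rw [Multiset.map_map]
    exact Multiset.attach_map_val _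
  -- `qV = ∏ (X - r)` over `V` maps to `qΩ`
  set qV : Polynomial V := (s.map fun r => X - C r).prod with hqVdef
  have hqV : qV.map V.subtype = qΩ := by
    have h1 : qV.map V.subtype = ((s.map Subtype.val).map fun ρ : Ω => X - C ρ).prod := by
      rw [hqVdef, Polynomial.map_multiset_prod, Multiset.map_map, Multiset.map_map]
      congr 1
      refine Multiset.map_congr rfl fun r _ => ?_
      simp only [Function.comp_apply, Polynomial.map_sub, Polynomial.map_X, Polynomial.map_C]
      rfl
    rw [h1, hs, ← hsplit.eq_prod_roots_of_monic hmon]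
  -- its reduction `qt = ∏ (X - r̄)` has coefficients in `Mv`
  set qt := qV.map (residue V) with hqtdef
  have hqt : qt = ((s.map (residue V)).map fun b => X - C b).prod := by
    rw [hqtdef, hqVdef, Polynomial.map_multiset_prod, Multiset.map_map, Multiset.map_map]
    congr 1
    refine Multiset.map_congr rfl fun r _ => ?_
    simp only [Function.comp_apply, Polynomial.map_sub, Polynomial.map_X, Polynomial.map_C]
  have hcoef : ∀ i, (qV.coeff i : Ω) = algebraMap M Ω (q.coeff i) := fun i => by
    have h := congrArg (fun p : Polynomial Ω => p.coeff i) hqV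
    simp only [Polynomial.coeff_map] at h
    rw [hqΩdef, Polynomial.coeff_map] at h
    exact h
  have hlifts : qt ∈ Polynomial.lifts (algebraMap (residueSubfield M V) (ResidueField V)) := by
    rw [lifts_iff_coeff_lifts]
    intro i
    rw [hqtdef, Polynomial.coeff_map]
    have hmem : algebraMap M Ω (q.coeff i) ∈ V := by rw [← hcoef]; exact (qV.coeff i).2
    have heq : qV.coeff i = ⟨algebraMap M Ω (q.coeff i), hmem⟩ := Subtype.ext (hcoef i)
    rw [heq]
    exact ⟨⟨_, residue_mem_residueSubfield M V (q.coeff i) hmem⟩, rfl⟩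
  obtain ⟨q₀, hq₀⟩ := (mem_lifts _).mp hlifts
  have hprodmon : (((s.map (residue V)).map fun b => X - C b).prod).Monic :=
    monic_multiset_prod_of_monic _ _ fun b _ => monic_X_sub_C b
  have hq₀map : q₀.map (algebraMap (residueSubfield M V) (ResidueField V)) =
      ((s.map (residue V)).map fun b => X - C b).prod := hq₀.trans hqt
  have hinj := (algebraMap (residueSubfield M V) (ResidueField V)).injective
  refine ⟨s, q₀, hs, monic_of_injective hinj (by rw [hq₀map]; exact hprodmon), ?_, hq₀map⟩
  -- degrees
  rw [← natDegree_map_eq_of_injective hinj, hq₀map, natDegree_multiset_prod_X_sub_C_eq_card,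
    Multiset.card_map, ← natDegree_map_eq_of_injective (algebraMap M Ω).injective q, ← hqΩdef,
    hsplit.natDegree_eq_card_roots, ← hs, Multiset.card_map]

/-! ### Degrees of simple extensions inside a field -/

/-- `[F(a) : F] = deg minpoly_F(a)`, in `Subfield.relfinrank` form. [folklore] -/
theorem relfinrank_adjoin_simple_eq_natDegree {Φ : Type u} [Field Φ] (F : Subfield Φ) {a : Φ}
    (ha : IsIntegral F a) :
    Subfield.relfinrank F (IntermediateField.adjoin F ({a} : Set Φ)).toSubfield =
      (minpoly F a).natDegree := by
  rw [relfinrank_toSubfield_eq_finrank, IntermediateField.adjoin.finrank ha]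

/-- `F(a) ≤ T` for subfields `F ≤ T` and `a ∈ T`. [folklore] -/
theorem adjoin_simple_toSubfield_le {Φ : Type u} [Field Φ] {F T : Subfield Φ} (hFT : F ≤ T)
    {a : Φ} (haT : a ∈ T) : (IntermediateField.adjoin F ({a} : Set Φ)).toSubfield ≤ T := by
  have h1 : IntermediateField.adjoin F ({a} : Set Φ) ≤ Subfield.extendScalars hFT :=
    IntermediateField.adjoin_le_iff.mpr (Set.singleton_subset_iff.mpr haT)
  exact fun y hy => h1 hy

/-! ### A primitive element of the residue field extension of a finite unramified extension -/

/-- **A primitive residue.** For `N|F` finite unramified inside `(Ω, V)` (`[N : F] = [Nv : Fv]`,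
`Nv|Fv` separable), the finite separable extension `Nv|Fv` has a primitive element `ā`
(`Field.exists_primitive_element`): `ā ∈ Nv` separable over `Fv` with
`deg minpoly_{Fv}(ā) = [Nv : Fv] = [N : F]`. [folklore] -/
theorem IsUnramifiedOver.exists_primitive_residue {F N : Subfield Ω}
    (hN : IsUnramifiedOver V F N) :
    ∃ ā : ResidueField V, ā ∈ residueSubfield N V ∧ IsIntegral (residueSubfield F V) ā ∧
      IsSeparable (residueSubfield F V) ā ∧
      (minpoly (residueSubfield F V) ā).natDegree = Subfield.relfinrank F N := by
  obtain ⟨hFN, hNpos, hNdeg, hsep, -⟩ := hN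
  have hFvNv : residueSubfield F V ≤ residueSubfield N V := residueSubfield_subfield_mono hFN
  set Nv' : IntermediateField (residueSubfield F V) (ResidueField V) :=
    Subfield.extendScalars hFvNv with hNv'def
  have hfr : Module.finrank (residueSubfield F V) Nv' = Subfield.relfinrank F N := by
    rw [hNdeg, Subfield.relfinrank_eq_finrank_of_le hFvNv]
  haveI : FiniteDimensional (residueSubfield F V) Nv' :=
    Module.finite_of_finrank_pos (by rw [hfr]; exact hNpos)
  haveI : Algebra.IsSeparable (residueSubfield F V) Nv' := ⟨fun r => by
    have h := hsep (r : ResidueField V) r.2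
    unfold IsSeparable at h ⊢
    rw [← minpoly.algebraMap_eq (algebraMap Nv' (ResidueField V)).injective r]
    exact h⟩
  obtain ⟨α, hα⟩ := Field.exists_primitive_element (residueSubfield F V) Nv'
  have hαint : IsIntegral (residueSubfield F V) α := Algebra.IsIntegral.isIntegral α
  have hαint' : IsIntegral (residueSubfield F V) (α : ResidueField V) := hαint.algebraMap
  have hadj : IntermediateField.adjoin (residueSubfield F V) {(α : ResidueField V)} = Nv' := by
    rw [← IntermediateField.lift_adjoin_simple, hα, IntermediateField.lift_top]
  refine ⟨α, α.2, hαint', hsep _ α.2, ?_⟩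
  rw [← IntermediateField.adjoin.finrank hαint', hadj, hfr]

/-! ### Residues of conjugates over a henselian subfield -/

/-- **Distinct residues of the conjugates.** Let `F ≤ Ω` be henselian, `a ∈ V` integral over
`F` with residue `ā` separable over `Fv` and `deg minpoly_F(a) ≤ deg minpoly_{Fv}(ā)`. Then the
roots of `μ = minpoly_F(a)` lie in `V` (`IsHenselianField.mem_of_aeval_minpoly`), the two
degrees are equal, and the residues of the roots (with multiplicity) are pairwise distinct:
the reduction `μ₀ ∈ Fv[X]` of `μ` (`exists_monic_map_eq_prod_residue`) is monic with
`μ₀(ā) = 0`, hence equal to the separable `minpoly_{Fv}(ā)`. [folklore] -/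
theorem IsHenselianField.exists_roots_lift_nodup [IsAlgClosed Ω] {F : Subfield Ω}
    (hF : IsHenselianField F (V.comap (algebraMap F Ω))) {a : Ω} (haV : a ∈ V)
    (haint : IsIntegral F a) (hsep : IsSeparable (residueSubfield F V) (residue V ⟨a, haV⟩))
    (hdeg : (minpoly F a).natDegree ≤
      (minpoly (residueSubfield F V) (residue V ⟨a, haV⟩)).natDegree) :
    ∃ s : Multiset V, s.map Subtype.val = ((minpoly F a).map (algebraMap F Ω)).roots ∧
      (s.map (residue V)).Nodup ∧
      (minpoly F a).natDegree =
        (minpoly (residueSubfield F V) (residue V ⟨a, haV⟩)).natDegree := by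
  have hāint : IsIntegral (residueSubfield F V) (residue V ⟨a, haV⟩) := hsep.isIntegral
  have hμ0 : (minpoly F a).map (algebraMap F Ω) ≠ 0 := ((minpoly.monic haint).map _).ne_zero
  have hrootsμ : ∀ r ∈ ((minpoly F a).map (algebraMap F Ω)).roots, r ∈ V := fun r hr =>
    hF.mem_of_aeval_minpoly V haint
      (by rw [aeval_def, ← eval_map]; exact (mem_roots hμ0).mp hr) haV
  obtain ⟨s, μ₀, hs, hμ₀mon, hμ₀deg, hμ₀map⟩ :=
    exists_monic_map_eq_prod_residue V F (minpoly.monic haint) hrootsμ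
  have haroot : a ∈ ((minpoly F a).map (algebraMap F Ω)).roots := by
    rw [mem_roots hμ0, IsRoot.def, eval_map, ← aeval_def]
    exact minpoly.aeval F a
  have has : (⟨a, haV⟩ : V) ∈ s := by
    have h : a ∈ s.map Subtype.val := by rw [hs]; exact haroot
    obtain ⟨r, hr, hra⟩ := Multiset.mem_map.mp h
    have hr' : r = ⟨a, haV⟩ := Subtype.ext hra
    rwa [hr'] at hr
  have hμ₀roots : (μ₀.map (algebraMap _ (ResidueField V))).roots = s.map (residue V) := by
    rw [hμ₀map, roots_multiset_prod_X_sub_C]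
  have hāμ₀ : aeval (residue V ⟨a, haV⟩) μ₀ = 0 := by
    have h : residue V ⟨a, haV⟩ ∈ (μ₀.map (algebraMap _ (ResidueField V))).roots := by
      rw [hμ₀roots]
      exact Multiset.mem_map_of_mem _ has
    have h' := (mem_roots ((hμ₀mon.map _).ne_zero)).mp h
    rwa [IsRoot.def, eval_map, ← aeval_def] at h'
  have hdvd : minpoly (residueSubfield F V) (residue V ⟨a, haV⟩) ∣ μ₀ := minpoly.dvd _ _ hāμ₀
  have hle' : (minpoly (residueSubfield F V) (residue V ⟨a, haV⟩)).natDegree ≤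
      (minpoly F a).natDegree := by
    rw [← hμ₀deg]
    exact natDegree_le_of_dvd hdvd hμ₀mon.ne_zero
  have heq := le_antisymm hdeg hle'
  have hμ₀eq : μ₀ = minpoly (residueSubfield F V) (residue V ⟨a, haV⟩) :=
    eq_of_monic_of_dvd_of_natDegree_le (minpoly.monic hāint) hμ₀mon hdvd (by rw [hμ₀deg, heq])
  refine ⟨s, hs, ?_, heq⟩
  rw [← hμ₀roots]
  refine nodup_roots (Polynomial.Separable.map ?_)
  rw [hμ₀eq]
  exact hsep

/-- **Counting residues of conjugates over a henselian subfield.** Let `E ≤ Ω` be henselian,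
`a ∈ V` integral over `E` with residue `ā`, and suppose the residues of the roots of
`ν = minpoly_E(a)` (which lie in `V`, lifted to the multiset `s`) are pairwise distinct. Then
`deg ν ≤ deg minpoly_{Ev}(ā)`: every root of `ν` is `σ(a)` for an `E`-automorphism `σ`
stabilising `V` and `𝔪_V` (`IsHenselianField.aeval_mem_iff_of_aeval_minpoly`), so its residue
is a root of `minpoly_{Ev}(ā)` (apply `σ` to a lift `Φ ∈ (V ∩ E)[X]` of it,
`exists_lift_of_residueSubfield`), and `ν` has `deg ν` roots with distinct residues. [folklore] -/
theorem IsHenselianField.natDegree_minpoly_le_of_nodup [IsAlgClosed Ω] {E : Subfield Ω}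
    (hE : IsHenselianField E (V.comap (algebraMap E Ω))) {a : Ω} (haV : a ∈ V)
    (haint : IsIntegral E a) (hāint : IsIntegral (residueSubfield E V) (residue V ⟨a, haV⟩))
    {s : Multiset V} (hs : s.map Subtype.val = ((minpoly E a).map (algebraMap E Ω)).roots)
    (hnd : (s.map (residue V)).Nodup) :
    (minpoly E a).natDegree ≤
      (minpoly (residueSubfield E V) (residue V ⟨a, haV⟩)).natDegree := by
  have hν0 : (minpoly E a).map (algebraMap E Ω) ≠ 0 := ((minpoly.monic haint).map _).ne_zero
  have hcard : Multiset.card (s.map (residue V)) = (minpoly E a).natDegree := by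
    rw [Multiset.card_map, ← Multiset.card_map Subtype.val, hs,
      ← (IsAlgClosed.splits _).natDegree_eq_card_roots,
      natDegree_map_eq_of_injective (algebraMap E Ω).injective]
  -- the residues of the roots are roots of `φ = minpoly_{Ev}(ā)`
  obtain ⟨Φ, hΦ⟩ :=
    exists_lift_of_residueSubfield V E (minpoly (residueSubfield E V) (residue V ⟨a, haV⟩))
  have hΦa : V.valuation (aeval a Φ) < 1 := (hΦ a haV).2.mpr (minpoly.aeval _ _)
  have hroot : ∀ b ∈ s.map (residue V),
      aeval b (minpoly (residueSubfield E V) (residue V ⟨a, haV⟩)) = 0 := by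
    intro b hb
    obtain ⟨r, hr, rfl⟩ := Multiset.mem_map.mp hb
    have hrroot : (r : Ω) ∈ ((minpoly E a).map (algebraMap E Ω)).roots := by
      rw [← hs]
      exact Multiset.mem_map_of_mem _ hr
    have hr0 : aeval (r : Ω) (minpoly E a) = 0 := by
      have h := (mem_roots hν0).mp hrroot
      rwa [IsRoot.def, eval_map, ← aeval_def] at h
    have h1 := (hE.aeval_mem_iff_of_aeval_minpoly V haint hr0 Φ).2.mp hΦa
    exact (hΦ r r.2).2.mp h1
  have hφ0 : (minpoly (residueSubfield E V) (residue V ⟨a, haV⟩)).map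
      (algebraMap (residueSubfield E V) (ResidueField V)) ≠ 0 :=
    ((minpoly.monic hāint).map _).ne_zero
  rw [← hcard, ← natDegree_map_eq_of_injective
    (algebraMap (residueSubfield E V) (ResidueField V)).injective (minpoly _ _)]
  refine le_trans (Multiset.card_le_card
    ((Multiset.le_iff_subset hnd).mpr fun b hb => ?_)) (card_roots' _)
  rw [mem_roots hφ0, IsRoot.def, eval_map, ← aeval_def]
  exact hroot b hb

end Literature.AlgebraicGeometry.Resolution
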